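import Literature.MathematicalPhysics.QuantumFieldTheory.Dimock2011to13.LocalizationSumDecay
import HarnessLib

/-!
# Dimock, *Ultraviolet stability for QED in d = 3*, §4.2.1 LEMMA 19 proof, part B (446)–(448): the sum of the
# boundary activities over the polymers meeting `L^{K−j}δΛ_{j−1}` — PROVED on the cell's torus polymer model

Topic `Literature/MathematicalPhysics/QuantumFieldTheory/Dimock2011to13`; sibling of `QED3LargeFieldFermionIntegration`
(LEMMA 19 (435) assembled from (445) and (448): `lemma19_of_445_448`, `lemma19`; part A (436)–(441)) and of
`LocalizationSumDecay` ((sudsy) summed over sub-polymers, `sum_doms_subset_exp_le`).  This file supplies the input (448)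
from the basic bound (446), i.e. the polymer-sum bookkeeping (447)–(448), on the cell's periodic polymer model
(`Reblocking.doms`, `torusTreeLen`, the constants `κ₀(4·2^d, 2d)`, `K₀(4·2^d, 2d)` of `B12TreeDecay` BY NAME).

statement-level skeleton of published theorems with citation tags; proofs where landed; nothing here is a claim about the Yang–Mills mass gap

**Citation header (reproduction of PUBLISHED work; YM LIT SWEEP seat p11, zero weight for the YM-INPRINT tokens).**
J. Dimock, *Ultraviolet stability for QED in d = 3*, Ann. Henri Poincaré **23** (2022) 2113–2205 (= arXiv:2009.01156v2)
[Dimock2022UVStabilityQED3], §4.2.1, LEMMA 19 proof part B, p.60 L1–95 of the held text layer `paper:arxiv-2009.01156`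
(read this session).  Verbatim (text layer → Unicode): *"We need a bound on the latter quantity. We have our basic bound (40)
`‖B^{(K)}_{j,Π}(X)‖_{h_K I^#_K, LI_K} ≤ e_K^{1∕4−8ε} exp(−κ d_{L^{−(K−j)}M}(X))` (446)  We need to sum this over connected
unions of `L^{−(K−j)}M` cubes `X` with `X ∩ δΛ_{j−1} ≠ ∅`. Instead we let `X = L^{K−j}Y` and sum over `M` cubes. This gives
`‖B^{(K)}_{j,Π}‖_{h_K I^#_K, LI_K} ≤ e_K^{1∕4−8ε} Σ_{Y ∩ L^{K−j}δΛ_{j−1} ≠ ∅} exp(−κ d_M(Y)) ≤ 𝒪(1)e_K^{1∕4−8ε}|L^{K−j}δΛ_{j−1}|_M`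
(447)  Now `L^{K−j}δΛ_{j−1}` is a subset of `𝕋^{−j}_{N−j}`, The number of unit cubes in this set is the number of centers of
`L^j` cubes, which in our notation is `|(L^{K−j}δΛ_{j−1})^{(j)}|`. This is the same as `|δΛ^{(j)}_{j−1}|` by the scale
invariance of the latter. Hence the number of `M` cubes is `|L^{K−j}δΛ_{j−1}|_M = M^{−3}|δΛ^{(j)}_{j−1}|`. Now sum over `j`
and get `‖B_{K,Π}‖_{h_K I^#_K, LI_K} ≤ 𝒪(1) Σ_{j=1}^{K} e_K^{1∕4−8ε}M^{−3}|δΛ^{(j)}_{j−1}| ≤ 𝒪(1)e_K^{1∕4−8ε}M^{−3}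
Σ_{j=1}^{K}|δΛ^{(j)}_{j−1}|` (448)  We throw away the small factor `𝒪(1)e_K^{1∕4−8ε}M^{−3} ≤ 1`."*

**What is formalised.**
* §1 **`sum_doms_meet_exp_le`** — the polymer sum of (447) on the model: for `κ ≥ κ₀(4·2^d, 2d)` and any cube set
  `S`, `Σ_{Y ∈ 𝒟, Y ∩ S ≠ ∅} e^{−κ d(Y)} ≤ K₀(4·2^d, 2d)·|S|` — the union bound over the cubes of `S`
  (`LocalizationSumDecay.sum_le_sum_mem`) and the per-cube sum (summing0) (`Reblocking.sum_domsAt_exp_le`); the printed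
  `𝒪(1)` is `K₀`.
* §2 **`eq447`** — (446) ⟹ (447): activities `B(Y)` in a seminormed group with `‖B(Y)‖ ≤ e·exp(−κ d(Y))` on `𝒟` have
  `Σ_{Y ∩ S ≠ ∅} ‖B(Y)‖ ≤ e·K₀·|S|` and `‖Σ_{Y ∩ S ≠ ∅} B(Y)‖ ≤ e·K₀·|S|` (`norm_sum_meet_le`).
* §3 **`eq448`** — the sum over `j`: per-scale bounds `b_j ≤ C·e·|S_j|_M` with the printed cube count
  `|S_j|_M = M^{−3}·m_j` (`m_j = |δΛ^{(j)}_{j−1}|`, supplied as data — the scale-invariance sentence is bookkeeping of the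
  paper's blocking conventions, not re-derived) give `Σ_j b_j ≤ (C·e·M^{−3})·Σ_j m_j`, the hypothesis `h448` of
  `QED3LargeFieldFermionIntegration.lemma19` with `t = C e_K^{1∕4−8ε} M^{−3}`.
* The assembly with `QED3LargeFieldFermion.lemma19` (LEMMA 19 (435) with part B discharged to (446): feed `h448 :=
  eq448_of_446 …`, `ht := small_factor_le_one …`) is one line in a file importing both; it is left to
  `QED3LargeFieldFermionIntegration` (this file deliberately does not import it).

**Declared divergences.**  (i) The cell's polymer model measures `d(Y)` by `torusTreeLen` (the tree length of
`TreeLengthTorus`), the stand-in for `d_M(Y)` used throughout `Dimock2011to13/`; (ii) the norms `‖·‖_{h_K I^#_K, LI_K}`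
are not modelled — §2 is stated in an arbitrary seminormed additive group; (iii) (444)–(445) (the comparison of norms via
[31] (147) and the appendix of [30]) are inputs of `lemma19_of_445_448`, not touched here.
-/

noncomputable section

namespace Literature.MathematicalPhysics.QuantumFieldTheory.Dimock2011to13.QED3BoundaryActivitySum

open Real Finset
open Literature.MathematicalPhysics.QuantumFieldTheory.Balaban1983to89.TreeLengthTorus
open Literature.MathematicalPhysics.QuantumFieldTheory.Balaban1983to89.TreeLengthTorusTransfer
open Literature.MathematicalPhysics.QuantumFieldTheory.Balaban1983to89.B12TreeDecay (kappa₀ K₀ K₀_pos)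
open Literature.MathematicalPhysics.QuantumFieldTheory.Dimock2011to13.Reblocking
open Literature.MathematicalPhysics.QuantumFieldTheory.Dimock2011to13.LocalizationSumDecay (sum_le_sum_mem)

variable {d n : ℕ} [NeZero n]

/-! ## §1 The polymer sum of (447): `Σ_{Y ∩ S ≠ ∅} e^{−κ d_M(Y)} ≤ 𝒪(1)|S|_M` -/

/-- The polymers meeting a cube set `S`: `{Y ∈ 𝒟 : Y ∩ S ≠ ∅}` — the index set of (447)
*"`Σ_{Y ∩ L^{K−j}δΛ_{j−1} ≠ ∅}`"*. [cite: Dimock2022UVStabilityQED3, §4.2.1 Lemma 19 proof (447) p.60 L56–66] -/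
def domsMeet (S : Finset (TPt d n)) : Finset (Finset (TPt d n)) :=
  (doms d n).filter fun Y => (Y ∩ S).Nonempty

/-- Membership in `domsMeet`. [cite: Dimock2022UVStabilityQED3, §4.2.1 Lemma 19 proof (447) p.60 L56–66] -/
theorem mem_domsMeet {S Y : Finset (TPt d n)} : Y ∈ domsMeet S ↔ Y ∈ doms d n ∧ (Y ∩ S).Nonempty := by
  rw [domsMeet, mem_filter]

/-- **(447), the polymer sum**: for `κ ≥ κ₀(4·2^d, 2d)` and every cube set `S`,
`Σ_{Y ∈ 𝒟, Y ∩ S ≠ ∅} e^{−κ d(Y)} ≤ K₀(4·2^d, 2d)·|S|` — every such `Y` contains a cube of `S` (union bound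
`sum_le_sum_mem`), and the sum over the polymers through a fixed cube is `≤ K₀` ((summing0), `sum_domsAt_exp_le`).  The
printed `𝒪(1)` is `K₀`. [cite: Dimock2022UVStabilityQED3, §4.2.1 Lemma 19 proof (447) p.60 L52–66] -/
theorem sum_doms_meet_exp_le (S : Finset (TPt d n)) {κ : ℝ} (hκ : kappa₀ (4 * 2 ^ d) (2 * d) ≤ κ) :
    ∑ Y ∈ domsMeet S, exp (-κ * torusTreeLen Y) ≤ K₀ (4 * 2 ^ d) (2 * d) * S.card := by
  classical
  have hne : ∀ Y ∈ domsMeet S, (Y ∩ S).Nonempty := fun Y hY => (mem_domsMeet.1 hY).2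
  have h1 := sum_le_sum_mem (domsMeet S) S (fun Y => exp (-κ * torusTreeLen Y)) (fun Y _ => (exp_pos _).le) hne
  have h2 : ∀ c ∈ S, ∑ Y ∈ (domsMeet S).filter (fun Y => c ∈ Y), exp (-κ * torusTreeLen Y)
      ≤ K₀ (4 * 2 ^ d) (2 * d) := by
    intro c _
    refine le_trans (sum_le_sum_of_subset_of_nonneg ?_ fun Y _ _ => (exp_pos _).le) (sum_domsAt_exp_le c hκ)
    intro Y hY
    rw [mem_filter, mem_domsMeet] at hY
    exact mem_domsAt.2 ⟨hY.2, (mem_doms.1 hY.1.1).2⟩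
  calc ∑ Y ∈ domsMeet S, exp (-κ * torusTreeLen Y)
      ≤ ∑ c ∈ S, ∑ Y ∈ (domsMeet S).filter (fun Y => c ∈ Y), exp (-κ * torusTreeLen Y) := h1
    _ ≤ ∑ _c ∈ S, K₀ (4 * 2 ^ d) (2 * d) := sum_le_sum h2
    _ = K₀ (4 * 2 ^ d) (2 * d) * S.card := by rw [sum_const, nsmul_eq_mul, mul_comm]

/-! ## §2 (446) ⟹ (447): summing the basic bound over the polymers meeting `S` -/

variable {V : Type*} [SeminormedAddCommGroup V]

/-- **(446) ⟹ (447)**: if the activities obey the basic bound `‖B(Y)‖ ≤ e·exp(−κ d(Y))` on `𝒟` (`e = e_K^{1∕4−8ε} ≥ 0`,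
`κ ≥ κ₀`), then `Σ_{Y ∩ S ≠ ∅} ‖B(Y)‖ ≤ e·K₀·|S|`. [cite: Dimock2022UVStabilityQED3, §4.2.1 Lemma 19 proof (446)–(447)
p.60 L36–66] -/
theorem eq447 (B : Finset (TPt d n) → V) (S : Finset (TPt d n)) {e κ : ℝ} (he : 0 ≤ e)
    (hκ : kappa₀ (4 * 2 ^ d) (2 * d) ≤ κ) (h446 : ∀ Y ∈ doms d n, ‖B Y‖ ≤ e * exp (-κ * torusTreeLen Y)) :
    ∑ Y ∈ domsMeet S, ‖B Y‖ ≤ e * (K₀ (4 * 2 ^ d) (2 * d) * S.card) := by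
  calc ∑ Y ∈ domsMeet S, ‖B Y‖ ≤ ∑ Y ∈ domsMeet S, e * exp (-κ * torusTreeLen Y) :=
        sum_le_sum fun Y hY => h446 Y (mem_domsMeet.1 hY).1
    _ = e * ∑ Y ∈ domsMeet S, exp (-κ * torusTreeLen Y) := by rw [mul_sum]
    _ ≤ e * (K₀ (4 * 2 ^ d) (2 * d) * S.card) := mul_le_mul_of_nonneg_left (sum_doms_meet_exp_le S hκ) he

/-- **(447) for the summed activity** `B_j = Σ_{Y ∩ S ≠ ∅} B_j(Y)`: `‖Σ_{Y ∩ S ≠ ∅} B(Y)‖ ≤ e·K₀·|S|`.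
[cite: Dimock2022UVStabilityQED3, §4.2.1 Lemma 19 proof (446)–(447) p.60 L36–66] -/
theorem norm_sum_meet_le (B : Finset (TPt d n) → V) (S : Finset (TPt d n)) {e κ : ℝ} (he : 0 ≤ e)
    (hκ : kappa₀ (4 * 2 ^ d) (2 * d) ≤ κ) (h446 : ∀ Y ∈ doms d n, ‖B Y‖ ≤ e * exp (-κ * torusTreeLen Y)) :
    ‖∑ Y ∈ domsMeet S, B Y‖ ≤ e * (K₀ (4 * 2 ^ d) (2 * d) * S.card) :=
  (norm_sum_le _ _).trans (eq447 B S he hκ h446)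

/-! ## §3 (448): the sum over the scales `j` -/

/-- **(448)**: per-scale bounds `b_j ≤ e·(K₀·c_j)` ((447), `c_j = |L^{K−j}δΛ_{j−1}|_M`) with the printed cube count
`c_j = M^{−3}·m_j` (`m_j = |δΛ^{(j)}_{j−1}|`: *"the number of M cubes is `|L^{K−j}δΛ_{j−1}|_M = M^{−3}|δΛ^{(j)}_{j−1}|`"*)
sum to `Σ_j b_j ≤ (K₀·e·M^{−3})·Σ_j m_j` — the shape `‖B‖ ≤ t·Σ_j m_j`, `t = 𝒪(1)e_K^{1∕4−8ε}M^{−3}`, fed to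
`QED3LargeFieldFermionIntegration.lemma19` (`h448`). [cite: Dimock2022UVStabilityQED3, §4.2.1 Lemma 19 proof (448)
p.60 L67–94] -/
theorem eq448 (s : Finset ℕ) (b c m : ℕ → ℝ) {e K0 M : ℝ} (h447 : ∀ j ∈ s, b j ≤ e * (K0 * c j))
    (hcount : ∀ j ∈ s, c j = (M ^ 3)⁻¹ * m j) :
    ∑ j ∈ s, b j ≤ (K0 * e * (M ^ 3)⁻¹) * ∑ j ∈ s, m j := by
  rw [mul_sum]
  refine sum_le_sum fun j hj => (h447 j hj).trans (le_of_eq ?_)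
  rw [hcount j hj]; ring

/-- **(448) for the norm of the total boundary term** `B_{K,Π} = Σ_j B_j`: `‖Σ_j B_j‖ ≤ (K₀·e·M^{−3})·Σ_j m_j`.
[cite: Dimock2022UVStabilityQED3, §4.2.1 Lemma 19 proof (448) p.60 L67–94] -/
theorem norm_sum_scales_le (s : Finset ℕ) (Bj : ℕ → V) (c m : ℕ → ℝ) {e K0 M : ℝ}
    (h447 : ∀ j ∈ s, ‖Bj j‖ ≤ e * (K0 * c j)) (hcount : ∀ j ∈ s, c j = (M ^ 3)⁻¹ * m j) :
    ‖∑ j ∈ s, Bj j‖ ≤ (K0 * e * (M ^ 3)⁻¹) * ∑ j ∈ s, m j :=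
  (norm_sum_le _ _).trans (eq448 s (fun j => ‖Bj j‖) c m h447 hcount)

/-- **«We throw away the small factor `𝒪(1)e_K^{1∕4−8ε}M^{−3} ≤ 1`»**: the smallness condition on `e_K` and `M` under
which (448) becomes `‖B_{K,Π}‖ ≤ Σ_j|δΛ^{(j)}_{j−1}|` — explicit: `K₀·e ≤ M³` (with `M > 0`).
[cite: Dimock2022UVStabilityQED3, §4.2.1 Lemma 19 proof (448) p.60 L85–94] -/
theorem small_factor_le_one {e K0 M : ℝ} (hM : 0 < M) (h : K0 * e ≤ M ^ 3) : K0 * e * (M ^ 3)⁻¹ ≤ 1 := by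
  have hM3 : 0 < M ^ 3 := pow_pos hM 3
  rw [← div_eq_mul_inv, div_le_one hM3]
  exact h

/-- **(446) ⟹ (448), assembled on one torus** (all scales read on a common cube set type — the per-scale tori of the
paper are identified here, a declared simplification): activities `B_j(Y)` with `‖B_j(Y)‖ ≤ e·exp(−κ d(Y))`, cube sets
`S_j` with `|S_j| = M^{−3} m_j`, give `‖Σ_j Σ_{Y ∩ S_j ≠ ∅} B_j(Y)‖ ≤ (K₀·e·M^{−3})·Σ_j m_j`.
[cite: Dimock2022UVStabilityQED3, §4.2.1 Lemma 19 proof (446)–(448) p.60 L36–94] -/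
theorem eq448_of_446 (s : Finset ℕ) (B : ℕ → Finset (TPt d n) → V) (S : ℕ → Finset (TPt d n)) (m : ℕ → ℝ)
    {e κ M : ℝ} (he : 0 ≤ e) (hκ : kappa₀ (4 * 2 ^ d) (2 * d) ≤ κ)
    (h446 : ∀ j ∈ s, ∀ Y ∈ doms d n, ‖B j Y‖ ≤ e * exp (-κ * torusTreeLen Y))
    (hcount : ∀ j ∈ s, ((S j).card : ℝ) = (M ^ 3)⁻¹ * m j) :
    ‖∑ j ∈ s, ∑ Y ∈ domsMeet (S j), B j Y‖ ≤ (K₀ (4 * 2 ^ d) (2 * d) * e * (M ^ 3)⁻¹) * ∑ j ∈ s, m j :=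
  norm_sum_scales_le s (fun j => ∑ Y ∈ domsMeet (S j), B j Y) (fun j => ((S j).card : ℝ)) m
    (fun j hj => norm_sum_meet_le (B j) (S j) he hκ (h446 j hj)) hcount


end Literature.MathematicalPhysics.QuantumFieldTheory.Dimock2011to13.QED3BoundaryActivitySum

end
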